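import Summits.QuantumFields.YangMills.Theorems.BalabanUVNodesN07PointFeasibilityOneLevelExistence
import Summits.QuantumFields.YangMills.Theorems.BalabanUVNodesN07PointFeasibilityOneLevelMarginSharp
import Summits.QuantumFields.YangMills.Theorems.BalabanUVNodesN07PointFeasibilityOneLevelForms
import HarnessLib

/-!
# DAG node N07 [B11], road R0′ — LEMMA (P) ONE LEVEL, file 6: WHAT THE SHARP MARGIN (★)₁ BUYS FOR THE POINT-NORMALISED SOLUTION —
# the a-priori ENERGY INEQUALITY `‖Δμ‖² ≤ Re⟨β, λ − a⟩` (every constant `a`) for the unique `μ` with `R(Δμ) = 0` and centre values `λ`,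
# `β` its block density (`Δ²μ = Q′ᴴβ`), replacing [B6]'s matched Green IDENTITY `‖Δμ‖² = ⟨β, Q′μ⟩`; hence `‖Δμ‖² ≤ n^{d∕2}‖Δ²μ‖·‖λ − a‖`

Cell `pub-ymgap` (HUMAN RULINGS D-0062 ∕ D-0149 ∕ D-0154), width seat `pub-ymgap-dag-n07-w5` g3, CLAIM-2 ∕ INTENT-2 cell bus 2026-08-28T13:07Z.
`--kind proof --supports stmt-QuantumFields-27364 --as helper` (K1⁹ per dag-lead KEY MAP v2; count-neutral).  THEOREMS ONLY.

THE PRINT.  [B5] = `[Balaban1984PropagatorsI]` CMP **95** (1984) 17–40: Sect. C p. 22 (`Q′_kΔ⁻²Q′*_k`, «positive also on the corresponding subspace»), p. 25 (`R`),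
(1.69)–(1.70) pp. 29–30; [B6] = `[Balaban1984PropagatorsII]` CMP **96** (1984) 223–250: (2.9)–(2.12) p. 225, (2.22) p. 226 («⟨∂A, ∂A⟩ ≥ γ₀ …» — the positivity of
`Δ_a` that yields (2.35)–(2.36) and [B11] (46) `|HB| ≤ B₀|B|`), (2.35)–(2.36) p. 228; [I] = `[Balaban1987RG1]` (0.4) p. 253.

WHY.  FILE 5 (`…OneLevelExistence`, p635372) gives, at one level with odd `n = 2c₀+1`, for every centre datum `λ` exactly one `μ` with `R(Δμ) = 0` and
`μ(ny + c₀) = λ(y)`; equivalently `Δ²μ = Q′ᴴβ` for a unique block density `β`.  In print's MATCHED problem (block MEANS prescribed) Green's identity gives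
`‖Δμ‖² = ⟨Q′ᴴβ, μ⟩ = ⟨β, Q′μ⟩` — the energy IS the pairing of density and datum.  In the POINT problem the pairing is with the CENTRE VALUES, and the
one-level margin theorem (★)₁ with the SHARP constant `1` (this base's g2 `…OneLevelMarginSharp.norm_sq_lapInv_le_centreForm_sharp`, p633313, over dag-n07-w7 g5's
`displayMargin_sharp_hDisp`) is EXACTLY the statement that the energy is still DOMINATED by that pairing: `‖Δ⁻¹Q′ᴴβ‖² ≤ Re Σ_y conj β(y)·(Δ⁻²Q′ᴴβ)(ny + c₀)`.
Reading `Δ⁻¹Q′ᴴβ = Δμ` and `Δ⁻²Q′ᴴβ = μ − μ̄` (so its centre values are `λ − μ̄`, and `β ⊥ 1` removes any constant) turns it into an a-priori inequality for the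
solution of FILE 5.

WHAT THIS FILE DOES (namespace `Summit.QuantumFields.YangMills.BalabanUVNodes.N07PointFeasibilityOneLevelEnergyBound`; `Δ = LapS (fine n M) n`, `Q′ = QsOp n M`,
`R = RT n M`, `Δ⁻¹ = LapSinv`, `P_const = Pker`).
* §1 (dictionary under `Δ²μ = Q′ᴴβ`) `sum_density_eq_zero` (`β ⊥ 1`) · `lapSinv_QsOpH_eq_LapS` (`Δ⁻¹Q′ᴴβ = Δμ`) · `lapSinv_lapSinv_QsOpH_eq_sub_Pker` (`Δ⁻²Q′ᴴβ = μ − P_const μ`) ·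
  `lapSinv_lapSinv_QsOpH_bpt` (its centre values are `λ(y) − κ`, `κ` the mean constant) · `centrePairing_eq` (`Σ_y conj β(y)·(Δ⁻²Q′ᴴβ)(ny+c₀) = ⟨β, λ − a⟩` for
  EVERY constant `a`).
* §2 ★★★ `norm_sq_LapS_le_re_pairing` — `n` odd, `3 ≤ n`: `Σ_x ‖(Δμ)(x)‖² ≤ Re⟨β, λ − a⟩` for every `a : ℂ` (the sharp margin, read on the solution).
* §3 `norm_sq_QsOpH_mulVec` (`Σ_x ‖(Q′ᴴβ)(x)‖² = (Σ_y ‖β(y)‖²)∕n^d`) · `norm_sq_density_eq` (`Σ_y ‖β(y)‖² = n^d·Σ_x ‖(Δ²μ)(x)‖²`).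
* §4 ★★ `norm_sq_LapS_le_of_centres` — Cauchy–Schwarz: `Σ_x ‖(Δμ)(x)‖² ≤ √(n^d Σ_x ‖(Δ²μ)(x)‖²) · √(Σ_y ‖λ(y) − a‖²)` for every `a` (an INTERPOLATION-type
  a-priori inequality for the point-normalised solution) · `norm_sq_LapS_le_of_RT_LapS_eq_zero_of_centres` (the same for FILE 5's `R`-form solution).
* §5 `norm_LapS_mulVec_apply_le` · ★ `norm_sq_LapS_mulVec_le` (`Σ‖Δv‖² ≤ (4d‖c‖²)²Σ‖v‖²` on any torus) · ★ `sqrt_norm_sq_LapS_le_of_centres` — THE CLOSED FORM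
  `‖Δμ‖ ≤ 4d·n²·√(n^d)·‖λ − a‖_{ℓ²(T₁)}` (M-uniform, crude).

HONEST FRAMING (binding).  Count-neutral helper; finite Fourier ∕ linear-algebra bookkeeping on ONE torus at ONE averaging level (block side `n` odd, `n ≥ 3`, true centres)
BY NAME over p633313 (sharp margin), p625080 (forms), p635372 (existence) and b05's typed letters; nothing of [B11]∕[B6]∕[B5]∕[3]'s analysis is asserted; the `ℓ²`
currency here is NOT print's weighted sup-norm currency of (46)∕(115); the MULTI-LEVEL `(P)_D` ∕ (★) stays OPEN (dag-n07-w7 g6's road); under road (a) of the K0 lineage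
nothing here is consumed — located-research insurance for the R0′-native junction.  `hker` at the record ∕ stub 1 ∕ K0⁷ ∕ K1⁹ NOT closed; N07 NOT discharged; counts
unmoved; no summit statement is proved by this seat — R4 closes the conditional finite-𝕋⁴ rung `BalabanLadder.UV` only; nothing continuum ∕ ℝ⁴ ∕ OS ∕ mass gap ∕ Clay.
No `sorry`, no `def`, no `instance`, no `notation`.
-/

noncomputable section

open scoped BigOperators Matrix ComplexConjugate

namespace Summit.QuantumFields.YangMills.BalabanUVNodes.N07PointFeasibilityOneLevelEnergyBound

open Literature.MathematicalPhysics.QuantumFieldTheory.Balaban1983to89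
open B5Prop11Plancherel (Tor fine)
open B5Block118 (bpt QsOp)
open B5Blocks16 (bpt_bijective blockOf_bpt)
open B5Action121 (LapS)
open B5LaplaceInverse (LapSinv Pker LapSinv_LapS_of_orth LapSinv_mul_LapS Pker_const)
open B5Substitution125 (sum_QsOp_adjoint)
open B5Adjoint130 (QsOp_adjoint_mulVec)
open B5Identities197Torus (RT)
open N07PointFeasibilityOneLevel (norm_sq_lapInv_le_centreForm_sharp)

variable {d : ℕ} (n : ℕ) [NeZero n] (M : Fin d → ℕ) [hM : ∀ μ, NeZero (M μ)]

/-! ## §1  Dictionary under `Δ²μ = Q′ᴴβ`: `β ⊥ 1`, `Δ⁻¹Q′ᴴβ = Δμ`, `Δ⁻²Q′ᴴβ = μ − μ̄`, and the centre pairing -/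

section Dictionary

/-- `Δ²μ = Q′ᴴβ ⇒ Σ_y β(y) = 0` (`Δ` maps into the complement of the constants, `Σ Q′ᴴβ = Σ β`). [cite: Balaban1984PropagatorsI, Sect. C p.22] -/
theorem sum_density_eq_zero (μ : Tor (fine n M) → ℂ) (β : Tor M → ℂ)
    (hbi : LapS (fine n M) (n : ℂ) *ᵥ (LapS (fine n M) (n : ℂ) *ᵥ μ) = (QsOp n M)ᴴ *ᵥ β) : ∑ y, β y = 0 := by
  have h1 : ∑ x, ((QsOp n M)ᴴ *ᵥ β) x = 0 := by
    rw [← hbi]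
    exact B5DivOrth.sum_LapS (fine n M) (n : ℂ) _
  rwa [sum_QsOp_adjoint] at h1

/-- `Δ²μ = Q′ᴴβ ⇒ Δ⁻¹Q′ᴴβ = Δμ` (`Δμ ⊥ 1` and `Δ⁻¹Δ = 1` there). [cite: Balaban1984PropagatorsI, Sect. C p.22] -/
theorem lapSinv_QsOpH_eq_LapS (μ : Tor (fine n M) → ℂ) (β : Tor M → ℂ)
    (hbi : LapS (fine n M) (n : ℂ) *ᵥ (LapS (fine n M) (n : ℂ) *ᵥ μ) = (QsOp n M)ᴴ *ᵥ β) :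
    LapSinv (fine n M) (n : ℂ) *ᵥ ((QsOp n M)ᴴ *ᵥ β) = LapS (fine n M) (n : ℂ) *ᵥ μ := by
  have hnc : (n : ℂ) ≠ 0 := by exact_mod_cast NeZero.ne n
  rw [← hbi, LapSinv_LapS_of_orth (fine n M) hnc _ (B5DivOrth.sum_LapS (fine n M) (n : ℂ) μ)]

/-- `Δ²μ = Q′ᴴβ ⇒ Δ⁻²Q′ᴴβ = μ − P_const μ` (`Δ⁻¹Δ = 1 − P_const`). [cite: Balaban1984PropagatorsI, Sect. C p.22] -/
theorem lapSinv_lapSinv_QsOpH_eq_sub_Pker (μ : Tor (fine n M) → ℂ) (β : Tor M → ℂ)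
    (hbi : LapS (fine n M) (n : ℂ) *ᵥ (LapS (fine n M) (n : ℂ) *ᵥ μ) = (QsOp n M)ᴴ *ᵥ β) :
    LapSinv (fine n M) (n : ℂ) *ᵥ (LapSinv (fine n M) (n : ℂ) *ᵥ ((QsOp n M)ᴴ *ᵥ β)) = μ - Pker (fine n M) (n : ℂ) *ᵥ μ := by
  rw [lapSinv_QsOpH_eq_LapS n M μ β hbi, Matrix.mulVec_mulVec, LapSinv_mul_LapS, Matrix.sub_mulVec, Matrix.one_mulVec]

/-- The centre values of `Δ⁻²Q′ᴴβ` are the centre values of `μ` minus the mean constant `κ = (P_const μ)(0)`. [cite: Balaban1987RG1, (0.4) p.253] -/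
theorem lapSinv_lapSinv_QsOpH_bpt (c₀ : Fin d → Fin n) (μ : Tor (fine n M) → ℂ) (β : Tor M → ℂ) (lam : Tor M → ℂ)
    (hbi : LapS (fine n M) (n : ℂ) *ᵥ (LapS (fine n M) (n : ℂ) *ᵥ μ) = (QsOp n M)ᴴ *ᵥ β) (hctr : ∀ y, μ (bpt n M y c₀) = lam y)
    (y : Tor M) :
    (LapSinv (fine n M) (n : ℂ) *ᵥ (LapSinv (fine n M) (n : ℂ) *ᵥ ((QsOp n M)ᴴ *ᵥ β))) (bpt n M y c₀) =
      lam y - (Pker (fine n M) (n : ℂ) *ᵥ μ) 0 := by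
  have hnc : (n : ℂ) ≠ 0 := by exact_mod_cast NeZero.ne n
  rw [lapSinv_lapSinv_QsOpH_eq_sub_Pker n M μ β hbi, Pi.sub_apply, hctr, Pker_const (fine n M) hnc μ]

/-- **The centre pairing is the pairing with the datum, up to ANY constant**: `Σ_y conj β(y)·(Δ⁻²Q′ᴴβ)(ny + c₀) = Σ_y conj β(y)·(λ(y) − a)` for every `a : ℂ`
(`β ⊥ 1`). [cite: Balaban1984PropagatorsI, Sect. C p.22; Balaban1987RG1, (0.4) p.253] -/
theorem centrePairing_eq (c₀ : Fin d → Fin n) (μ : Tor (fine n M) → ℂ) (β : Tor M → ℂ) (lam : Tor M → ℂ)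
    (hbi : LapS (fine n M) (n : ℂ) *ᵥ (LapS (fine n M) (n : ℂ) *ᵥ μ) = (QsOp n M)ᴴ *ᵥ β) (hctr : ∀ y, μ (bpt n M y c₀) = lam y) (a : ℂ) :
    star β ⬝ᵥ (fun y => (LapSinv (fine n M) (n : ℂ) *ᵥ (LapSinv (fine n M) (n : ℂ) *ᵥ ((QsOp n M)ᴴ *ᵥ β))) (bpt n M y c₀)) =
      star β ⬝ᵥ (fun y => lam y - a) := by
  have hβ0 := sum_density_eq_zero n M μ β hbi
  have hfun : (fun y => (LapSinv (fine n M) (n : ℂ) *ᵥ (LapSinv (fine n M) (n : ℂ) *ᵥ ((QsOp n M)ᴴ *ᵥ β))) (bpt n M y c₀)) =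
      (fun y => lam y - a) + fun _ => a - (Pker (fine n M) (n : ℂ) *ᵥ μ) 0 := by
    funext y
    rw [lapSinv_lapSinv_QsOpH_bpt n M c₀ μ β lam hbi hctr y, Pi.add_apply]
    ring
  rw [hfun, dotProduct_add]
  have hconst : star β ⬝ᵥ (fun _ : Tor M => a - (Pker (fine n M) (n : ℂ) *ᵥ μ) 0) = 0 := by
    simp only [dotProduct, Pi.star_apply, ← Finset.sum_mul, ← star_sum, hβ0, star_zero, zero_mul]
  rw [hconst, add_zero]

end Dictionary

/-! ## §2  The energy inequality from the sharp margin -/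

section Energy

/-- ★★★ **A-PRIORI ENERGY INEQUALITY FOR THE POINT-NORMALISED SOLUTION.**  `n` odd, `3 ≤ n`, `n = 2c₀+1`: if `Δ²μ = Q′ᴴβ` and `μ(ny + c₀) = λ(y)` for all `y`
(FILE 5: for every `λ` there is exactly one such `μ`, namely the `R(Δμ) = 0` representative), then for EVERY constant `a`
`Σ_x ‖(Δμ)(x)‖² ≤ Re Σ_y conj β(y)·(λ(y) − a)` — the one-level sharp margin (★)₁ (`norm_sq_lapInv_le_centreForm_sharp`, constant ONE) read on the solution.
Print's matched problem has the IDENTITY `‖Δμ‖² = ⟨β, Q′μ⟩` here ([B6] (2.22) road); the centre averaging of [I] (0.4) keeps it as an inequality.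
[cite: Balaban1984PropagatorsI, Sect. C p.22; Balaban1984PropagatorsII, (2.22) p.226, (2.35)-(2.36) p.228; Balaban1987RG1, (0.4) p.253] -/
theorem norm_sq_LapS_le_re_pairing (hn : Odd n) (h3 : 3 ≤ n) (c₀ : Fin d → Fin n) (hc₀ : ∀ ν, 2 * (c₀ ν : ℕ) + 1 = n)
    (μ : Tor (fine n M) → ℂ) (β : Tor M → ℂ) (lam : Tor M → ℂ)
    (hbi : LapS (fine n M) (n : ℂ) *ᵥ (LapS (fine n M) (n : ℂ) *ᵥ μ) = (QsOp n M)ᴴ *ᵥ β) (hctr : ∀ y, μ (bpt n M y c₀) = lam y) (a : ℂ) :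
    ∑ x, ‖(LapS (fine n M) (n : ℂ) *ᵥ μ) x‖ ^ 2 ≤ (star β ⬝ᵥ (fun y => lam y - a)).re := by
  have h := norm_sq_lapInv_le_centreForm_sharp n M hn h3 c₀ hc₀ β
  rwa [centrePairing_eq n M c₀ μ β lam hbi hctr a, lapSinv_QsOpH_eq_LapS n M μ β hbi] at h

end Energy

/-! ## §3  The size of the density: `‖β‖² = n^d‖Δ²μ‖²` -/

section Density

/-- `Σ_x ‖(Q′ᴴβ)(x)‖² = (Σ_y ‖β(y)‖²) ∕ n^d` (`Q′ᴴβ` is `β(y)∕n^d` on the `n^d` points of the block of `y`). [cite: Balaban1984PropagatorsI, (1.6) p.18, Sect. C p.22] -/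
theorem norm_sq_QsOpH_mulVec (β : Tor M → ℂ) :
    ∑ x, ‖((QsOp n M)ᴴ *ᵥ β) x‖ ^ 2 = (∑ y, ‖β y‖ ^ 2) / (n : ℝ) ^ d := by
  have hn0 : (n : ℝ) ≠ 0 := by exact_mod_cast NeZero.ne n
  rw [← (bpt_bijective n M).sum_comp (fun x => ‖((QsOp n M)ᴴ *ᵥ β) x‖ ^ 2), Fintype.sum_prod_type, Finset.sum_div]
  refine Finset.sum_congr rfl fun y _ => ?_
  have hval : ∀ j : Fin d → Fin n, ‖((QsOp n M)ᴴ *ᵥ β) (bpt n M y j)‖ ^ 2 = ‖β y‖ ^ 2 / ((n : ℝ) ^ d) ^ 2 := by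
    intro j
    rw [QsOp_adjoint_mulVec, blockOf_bpt, norm_mul, mul_pow, norm_div, norm_one, norm_pow, Complex.norm_natCast]
    ring
  simp only [hval, Finset.sum_const, Finset.card_univ, Fintype.card_pi, Fintype.card_fin, Finset.prod_const, nsmul_eq_mul,
    Nat.cast_pow]
  field_simp

/-- `Δ²μ = Q′ᴴβ ⇒ Σ_y ‖β(y)‖² = n^d · Σ_x ‖(Δ²μ)(x)‖²`. [cite: Balaban1984PropagatorsI, (1.6) p.18, Sect. C p.22] -/
theorem norm_sq_density_eq (μ : Tor (fine n M) → ℂ) (β : Tor M → ℂ)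
    (hbi : LapS (fine n M) (n : ℂ) *ᵥ (LapS (fine n M) (n : ℂ) *ᵥ μ) = (QsOp n M)ᴴ *ᵥ β) :
    ∑ y, ‖β y‖ ^ 2 = (n : ℝ) ^ d * ∑ x, ‖(LapS (fine n M) (n : ℂ) *ᵥ (LapS (fine n M) (n : ℂ) *ᵥ μ)) x‖ ^ 2 := by
  have hn0 : (n : ℝ) ^ d ≠ 0 := pow_ne_zero _ (by exact_mod_cast NeZero.ne n)
  rw [hbi, norm_sq_QsOpH_mulVec, mul_div_cancel₀ _ hn0]

end Density

/-! ## §4  Cauchy–Schwarz: `‖Δμ‖² ≤ √(n^d)‖Δ²μ‖·‖λ − a‖` -/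

section Interpolation

/-- Cauchy–Schwarz for the complex pairing: `Re Σ conj β·v ≤ √(Σ‖β‖²)·√(Σ‖v‖²)`. [folklore] -/
theorem re_star_dotProduct_le (β v : Tor M → ℂ) :
    (star β ⬝ᵥ v).re ≤ Real.sqrt (∑ y, ‖β y‖ ^ 2) * Real.sqrt (∑ y, ‖v y‖ ^ 2) := by
  have h1 : (star β ⬝ᵥ v).re ≤ ‖star β ⬝ᵥ v‖ := Complex.re_le_norm _
  have h2 : ‖star β ⬝ᵥ v‖ ≤ ∑ y, ‖β y‖ * ‖v y‖ := by
    refine (norm_sum_le _ _).trans (le_of_eq (Finset.sum_congr rfl fun y _ => ?_))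
    rw [Pi.star_apply, norm_mul, norm_star]
  have h3 : (∑ y, ‖β y‖ * ‖v y‖) ^ 2 ≤ (∑ y, ‖β y‖ ^ 2) * ∑ y, ‖v y‖ ^ 2 :=
    Finset.sum_mul_sq_le_sq_mul_sq Finset.univ (fun y => ‖β y‖) (fun y => ‖v y‖)
  have h4 : ∑ y, ‖β y‖ * ‖v y‖ ≤ Real.sqrt (∑ y, ‖β y‖ ^ 2) * Real.sqrt (∑ y, ‖v y‖ ^ 2) := by
    rw [← Real.sqrt_mul (Finset.sum_nonneg fun y _ => sq_nonneg _)]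
    exact Real.le_sqrt_of_sq_le h3
  exact h1.trans (h2.trans h4)

/-- ★★ **`‖Δμ‖² ≤ √(n^d·‖Δ²μ‖²) · ‖λ − a‖`** — `n` odd, `3 ≤ n`, `n = 2c₀+1`, `Δ²μ = Q′ᴴβ`, centre values `λ`, every constant `a`:
`Σ_x ‖(Δμ)(x)‖² ≤ √(n^d · Σ_x ‖(Δ²μ)(x)‖²) · √(Σ_y ‖λ(y) − a‖²)` (§2 ∘ Cauchy–Schwarz ∘ §3).  An interpolation-type a-priori inequality for the point-normalised
`R(Δμ) = 0` representative of FILE 5; with the torus bound `‖Δ²μ‖ ≤ 4dn²‖Δμ‖` §5 closes it to `‖Δμ‖ ≤ 4d·n²·√(n^d)·‖λ − a‖`.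
[cite: Balaban1984PropagatorsI, Sect. C p.22; Balaban1984PropagatorsII, (2.22) p.226, (2.35)-(2.36) p.228; Balaban1987RG1, (0.4) p.253] -/
theorem norm_sq_LapS_le_of_centres (hn : Odd n) (h3 : 3 ≤ n) (c₀ : Fin d → Fin n) (hc₀ : ∀ ν, 2 * (c₀ ν : ℕ) + 1 = n)
    (μ : Tor (fine n M) → ℂ) (β : Tor M → ℂ) (lam : Tor M → ℂ)
    (hbi : LapS (fine n M) (n : ℂ) *ᵥ (LapS (fine n M) (n : ℂ) *ᵥ μ) = (QsOp n M)ᴴ *ᵥ β) (hctr : ∀ y, μ (bpt n M y c₀) = lam y) (a : ℂ) :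
    ∑ x, ‖(LapS (fine n M) (n : ℂ) *ᵥ μ) x‖ ^ 2 ≤
      Real.sqrt ((n : ℝ) ^ d * ∑ x, ‖(LapS (fine n M) (n : ℂ) *ᵥ (LapS (fine n M) (n : ℂ) *ᵥ μ)) x‖ ^ 2) *
        Real.sqrt (∑ y, ‖lam y - a‖ ^ 2) := by
  have h := norm_sq_LapS_le_re_pairing n M hn h3 c₀ hc₀ μ β lam hbi hctr a
  have hcs := re_star_dotProduct_le M β (fun y => lam y - a)
  rw [norm_sq_density_eq n M μ β hbi] at hcs
  exact h.trans hcs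

/-- The same for the `R`-form solution of FILE 5 (the density `β` is supplied by `RT_LapS_eq_zero_iff_exists_biharmonic`).
[cite: Balaban1984PropagatorsI, p.25; Balaban1984PropagatorsII, (2.10)-(2.12) p.225, (2.22) p.226] -/
theorem norm_sq_LapS_le_of_RT_LapS_eq_zero_of_centres (hn : Odd n) (h3 : 3 ≤ n) (c₀ : Fin d → Fin n) (hc₀ : ∀ ν, 2 * (c₀ ν : ℕ) + 1 = n)
    (μ : Tor (fine n M) → ℂ) (lam : Tor M → ℂ) (hR : RT n M *ᵥ (LapS (fine n M) (n : ℂ) *ᵥ μ) = 0)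
    (hctr : ∀ y, μ (bpt n M y c₀) = lam y) (a : ℂ) :
    ∑ x, ‖(LapS (fine n M) (n : ℂ) *ᵥ μ) x‖ ^ 2 ≤
      Real.sqrt ((n : ℝ) ^ d * ∑ x, ‖(LapS (fine n M) (n : ℂ) *ᵥ (LapS (fine n M) (n : ℂ) *ᵥ μ)) x‖ ^ 2) *
        Real.sqrt (∑ y, ‖lam y - a‖ ^ 2) := by
  obtain ⟨β, hbi⟩ := (N07PointFeasibilityOneLevelExistence.RT_LapS_eq_zero_iff_exists_biharmonic n M μ).mp hR
  exact norm_sq_LapS_le_of_centres n M hn h3 c₀ hc₀ μ β lam hbi hctr a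

end Interpolation

/-! ## §5  The crude torus bound `‖Δv‖ ≤ 4d|c|²‖v‖` and the closed form `‖Δμ‖ ≤ 4d·n²·√(n^d)·‖λ − a‖` -/

section Closure

variable {d' : ℕ} (N : Fin d' → ℕ) [hN : ∀ μ, NeZero (N μ)]

omit hM in
/-- Pointwise size of the torus Laplacian: `‖(Δv)(x)‖ ≤ ‖c‖²·Σ_ν (2‖v(x)‖ + ‖v(x+e_ν)‖ + ‖v(x−e_ν)‖)`. [folklore] -/
theorem norm_LapS_mulVec_apply_le (c : ℂ) (v : Tor N → ℂ) (x : Tor N) :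
    ‖(LapS N c *ᵥ v) x‖ ≤ ‖c‖ ^ 2 * ∑ ν, (2 * ‖v x‖ + ‖v (x + B5Prop11Plancherel.unitVec N ν)‖ + ‖v (x - B5Prop11Plancherel.unitVec N ν)‖) := by
  rw [B5Action121.LapS_mulVec, Finset.mul_sum]
  refine (norm_sum_le _ _).trans (Finset.sum_le_sum fun ν _ => ?_)
  rw [norm_mul, norm_mul, Complex.norm_conj, ← sq]
  gcongr
  refine (norm_sub_le _ _).trans ?_
  gcongr
  refine (norm_sub_le _ _).trans ?_
  rw [norm_mul, Complex.norm_two]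

omit hM in
/-- ★ **`Σ_x ‖(Δv)(x)‖² ≤ (4d‖c‖²)²·Σ_x ‖v(x)‖²`** on any torus (Cauchy–Schwarz in `ν`, `(2a+b+c)² ≤ 8a²+4b²+4c²`, translation invariance of the sums).
[folklore] -/
theorem norm_sq_LapS_mulVec_le (c : ℂ) (v : Tor N → ℂ) :
    ∑ x, ‖(LapS N c *ᵥ v) x‖ ^ 2 ≤ (4 * d' * ‖c‖ ^ 2) ^ 2 * ∑ x, ‖v x‖ ^ 2 := by
  have hS : ∀ ν : Fin d', ∑ x, ‖v (x + B5Prop11Plancherel.unitVec N ν)‖ ^ 2 = ∑ x, ‖v x‖ ^ 2 := fun ν =>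
    Fintype.sum_equiv (Equiv.addRight (B5Prop11Plancherel.unitVec N ν)) _ _ fun _ => rfl
  have hS' : ∀ ν : Fin d', ∑ x, ‖v (x - B5Prop11Plancherel.unitVec N ν)‖ ^ 2 = ∑ x, ‖v x‖ ^ 2 := fun ν =>
    Fintype.sum_equiv (Equiv.subRight (B5Prop11Plancherel.unitVec N ν)) _ _ fun _ => rfl
  -- pointwise: `‖Δv x‖² ≤ ‖c‖⁴ · d · Σ_ν (8a² + 4b² + 4c²)`
  have hpt : ∀ x, ‖(LapS N c *ᵥ v) x‖ ^ 2 ≤ (‖c‖ ^ 2) ^ 2 * (d' * ∑ ν,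
      (8 * ‖v x‖ ^ 2 + 4 * ‖v (x + B5Prop11Plancherel.unitVec N ν)‖ ^ 2 + 4 * ‖v (x - B5Prop11Plancherel.unitVec N ν)‖ ^ 2)) := by
    intro x
    have h1 := norm_LapS_mulVec_apply_le N c v x
    have h0 : 0 ≤ ‖(LapS N c *ᵥ v) x‖ := norm_nonneg _
    have h2 : ‖(LapS N c *ᵥ v) x‖ ^ 2 ≤ (‖c‖ ^ 2 * ∑ ν, (2 * ‖v x‖ + ‖v (x + B5Prop11Plancherel.unitVec N ν)‖ +
        ‖v (x - B5Prop11Plancherel.unitVec N ν)‖)) ^ 2 := pow_le_pow_left₀ h0 h1 2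
    refine h2.trans ?_
    rw [mul_pow]
    gcongr
    refine (sq_sum_le_card_mul_sum_sq (s := Finset.univ) (f := fun ν => 2 * ‖v x‖ + ‖v (x + B5Prop11Plancherel.unitVec N ν)‖ +
        ‖v (x - B5Prop11Plancherel.unitVec N ν)‖)).trans ?_
    rw [Finset.card_univ, Fintype.card_fin]
    gcongr with ν _
    nlinarith [sq_nonneg (‖v (x + B5Prop11Plancherel.unitVec N ν)‖ - ‖v (x - B5Prop11Plancherel.unitVec N ν)‖),
      sq_nonneg (2 * ‖v x‖ - ‖v (x + B5Prop11Plancherel.unitVec N ν)‖ - ‖v (x - B5Prop11Plancherel.unitVec N ν)‖)]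
  calc ∑ x, ‖(LapS N c *ᵥ v) x‖ ^ 2
      ≤ ∑ x, (‖c‖ ^ 2) ^ 2 * (d' * ∑ ν, (8 * ‖v x‖ ^ 2 + 4 * ‖v (x + B5Prop11Plancherel.unitVec N ν)‖ ^ 2 +
          4 * ‖v (x - B5Prop11Plancherel.unitVec N ν)‖ ^ 2)) := Finset.sum_le_sum fun x _ => hpt x
    _ = (‖c‖ ^ 2) ^ 2 * (d' * (16 * d' * ∑ x, ‖v x‖ ^ 2)) := by
        rw [← Finset.mul_sum, ← Finset.mul_sum, Finset.sum_comm]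
        simp only [Finset.sum_add_distrib, ← Finset.mul_sum, hS, hS', Finset.sum_const, Finset.card_univ, Fintype.card_fin,
          nsmul_eq_mul]
        ring
    _ = (4 * d' * ‖c‖ ^ 2) ^ 2 * ∑ x, ‖v x‖ ^ 2 := by ring

/-- ★ **CLOSED FORM: `‖Δμ‖ ≤ 4d·n²·√(n^d)·‖λ − a‖_{ℓ²(T₁)}`** for the point-normalised solution — `n` odd, `3 ≤ n`, `n = 2c₀+1`, `Δ²μ = Q′ᴴβ`, centre values `λ`,
every constant `a`: `√(Σ_x ‖(Δμ)(x)‖²) ≤ 4d·n²·√(n^d)·√(Σ_y ‖λ(y) − a‖²)` (§4 ∘ `norm_sq_LapS_mulVec_le`; the constant is M-uniform and crude — the one-level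
`ℓ²`-analogue, for the CENTRE averaging, of the matched bound [B6] (2.35)–(2.36) ∕ [B11] (46) `|HB| ≤ B₀|B|`).
[cite: Balaban1984PropagatorsII, (2.22) p.226, (2.35)-(2.36) p.228; Balaban1987RG1, (0.4) p.253] -/
theorem sqrt_norm_sq_LapS_le_of_centres (hn : Odd n) (h3 : 3 ≤ n) (c₀ : Fin d → Fin n) (hc₀ : ∀ ν, 2 * (c₀ ν : ℕ) + 1 = n)
    (μ : Tor (fine n M) → ℂ) (β : Tor M → ℂ) (lam : Tor M → ℂ)
    (hbi : LapS (fine n M) (n : ℂ) *ᵥ (LapS (fine n M) (n : ℂ) *ᵥ μ) = (QsOp n M)ᴴ *ᵥ β) (hctr : ∀ y, μ (bpt n M y c₀) = lam y) (a : ℂ) :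
    Real.sqrt (∑ x, ‖(LapS (fine n M) (n : ℂ) *ᵥ μ) x‖ ^ 2) ≤
      4 * d * (n : ℝ) ^ 2 * Real.sqrt ((n : ℝ) ^ d) * Real.sqrt (∑ y, ‖lam y - a‖ ^ 2) := by
  set E := ∑ x, ‖(LapS (fine n M) (n : ℂ) *ᵥ μ) x‖ ^ 2 with hE
  set Λ := ∑ y, ‖lam y - a‖ ^ 2 with hΛ
  have hE0 : 0 ≤ E := Finset.sum_nonneg fun _ _ => sq_nonneg _
  have hnd : 0 ≤ (n : ℝ) ^ d := pow_nonneg (Nat.cast_nonneg n) d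
  have hK0 : 0 ≤ 4 * d * (n : ℝ) ^ 2 := by positivity
  -- `Σ‖Δ²μ‖² ≤ (4dn²)² E`
  have hcl := norm_sq_LapS_mulVec_le (fine n M) (n : ℂ) (LapS (fine n M) (n : ℂ) *ᵥ μ)
  rw [Complex.norm_natCast] at hcl
  -- §4: `E ≤ √(n^d Σ‖Δ²μ‖²) √Λ ≤ √(n^d) (4dn² √E) √Λ`
  have h4 := norm_sq_LapS_le_of_centres n M hn h3 c₀ hc₀ μ β lam hbi hctr a
  have hstep : Real.sqrt ((n : ℝ) ^ d * ∑ x, ‖(LapS (fine n M) (n : ℂ) *ᵥ (LapS (fine n M) (n : ℂ) *ᵥ μ)) x‖ ^ 2) ≤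
      Real.sqrt ((n : ℝ) ^ d) * (4 * d * (n : ℝ) ^ 2 * Real.sqrt E) := by
    rw [Real.sqrt_mul hnd]
    gcongr
    calc Real.sqrt (∑ x, ‖(LapS (fine n M) (n : ℂ) *ᵥ (LapS (fine n M) (n : ℂ) *ᵥ μ)) x‖ ^ 2)
        ≤ Real.sqrt ((4 * d * (n : ℝ) ^ 2) ^ 2 * E) := Real.sqrt_le_sqrt hcl
      _ = 4 * d * (n : ℝ) ^ 2 * Real.sqrt E := by rw [Real.sqrt_mul' _ hE0, Real.sqrt_sq hK0]
  have hmain : E ≤ Real.sqrt ((n : ℝ) ^ d) * (4 * d * (n : ℝ) ^ 2 * Real.sqrt E) * Real.sqrt Λ :=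
    h4.trans (mul_le_mul_of_nonneg_right hstep (Real.sqrt_nonneg _))
  -- divide by `√E`
  by_cases hE' : Real.sqrt E = 0
  · rw [hE']; positivity
  · have hpos : 0 < Real.sqrt E := lt_of_le_of_ne (Real.sqrt_nonneg _) (Ne.symm hE')
    have : Real.sqrt E ≤ Real.sqrt ((n : ℝ) ^ d) * (4 * d * (n : ℝ) ^ 2) * Real.sqrt Λ := by
      have h' : Real.sqrt E * Real.sqrt E ≤ (Real.sqrt ((n : ℝ) ^ d) * (4 * d * (n : ℝ) ^ 2) * Real.sqrt Λ) * Real.sqrt E := by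
        calc Real.sqrt E * Real.sqrt E = E := Real.mul_self_sqrt hE0
          _ ≤ Real.sqrt ((n : ℝ) ^ d) * (4 * d * (n : ℝ) ^ 2 * Real.sqrt E) * Real.sqrt Λ := hmain
          _ = (Real.sqrt ((n : ℝ) ^ d) * (4 * d * (n : ℝ) ^ 2) * Real.sqrt Λ) * Real.sqrt E := by ring
      exact le_of_mul_le_mul_right h' hpos
    calc Real.sqrt E ≤ Real.sqrt ((n : ℝ) ^ d) * (4 * d * (n : ℝ) ^ 2) * Real.sqrt Λ := this
      _ = 4 * d * (n : ℝ) ^ 2 * Real.sqrt ((n : ℝ) ^ d) * Real.sqrt Λ := by ring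

end Closure

end Summit.QuantumFields.YangMills.BalabanUVNodes.N07PointFeasibilityOneLevelEnergyBound

end
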